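import Literature.NumberTheory.Rogawski1990.LocalTransferAtOneOfPopulations           -- ★ p846349 (this seat): the junction's imports (`stableOrbitalIntegralRel_finset_sum_of_isLocSmooth`, `…_smul_fun`, `IsLocSmooth.const_smul`, CM additivity)
import Literature.NumberTheory.Rogawski1990.LocalNormFibreNonsplit                     -- ★ `IsLocalNormPair.charpoly_eq`, `charpoly_endoEmbLocal`
import Literature.NumberTheory.Rogawski1990.LocalTransferLinear                         -- ★ `isRegularElt_of_isLocalNormPair`
import Literature.LinearAlgebra.Matrix.RegularSemisimpleConjClassClosed                 -- ★ `continuous_charpoly_coeff`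
import HarnessLib

/-!
# Route (A) «SHALIKA» — the END's GERM FOLD: a local transfer at the identity of EVERY `f ∈ C_c^∞(G′_v)` from a germ expansion of the orbital integrals
# near `1`, reference pieces whose unipotent orbital integrals SPAN, and transfers of the reference pieces

Topic `NumberTheory/Rogawski1990`; namespace `Literature.NumberTheory.Rogawski1990`.  THEOREMS ONLY (no definition, no instance, no notation, no named fact, no `sorry`).
Cell `pub/hodgecm-mathlib`, crux H413, road «S3-tree» ROUTE (A) (architect A-83∕A-83b∕A-84, chair T10-42 (3)∕T10-43 (b): `stub_N6nsS3id ⟸ ‹SHALIKA› + GEN-χ(≤2) + ‹RANK› +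
S3-res`); END F0P3a-p03 (g15).  HC_CM is proved only modulo the cell's 2 remaining named inputs (hLiu418, h413) until rung 0 closes; this file is unconditional linear
algebra over its hypotheses — the germ data `(S, mU, Γ, hgerm)` are exactly the last conjunct of ★ `ShalikaGermExpansionNonsplit` (p846293), `hspan` is what ‹RANK› (an
invertible matrix of unipotent orbital integrals of the reference pieces) delivers, and `htr` is the PARTIAL HEAD `localTransferAtOne_of_hyperspecialLevel_le_two` at the
reference pieces.

THE MATHEMATICS.  Suppose `Φ(c, h) = Σ_{u ∈ S} Φ_U(u, h)·Γ_u(c)` for every `h ∈ C_c^∞` and every regular class `c` whose characteristic polynomial is near `(X − 1)³`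
(a neighbourhood `W_h` of the coefficient vector).  If `Φ_U(u, f) = Σ_i b_i Φ_U(u, g_i)` for all `u ∈ S` (the reference pieces span `f`'s unipotent row), then
`Φ(c, f) = Σ_i b_i Φ(c, g_i)` for regular `c` with coefficients in `W_f ∩ ⋂_i W_{g_i}`.  For `γ_H` near `1` in `H_v` EVERY class `c` with `Δ(γ_H, c) ≠ 0` is such a
class: `Δ` is supported on norm pairs (★ `TransferFactorData.eq_zero_of_not_rel`), a norm pair of a `G`-regular `γ_H` is regular (★ `isRegularElt_of_isLocalNormPair`)
with characteristic polynomial that of `ι_v(γ_H)` (★ `IsLocalNormPair.charpoly_eq`, ★ `charpoly_endoEmbLocal`), which depends continuously on `γ_H`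
(★ `continuous_endoEmbLocal`, ★ `continuous_charpoly_coeff`) and is `(X − 1)³` at `γ_H = 1`.  Hence `Σᶠ_c Δ·Φ(c, f) = Σ_i b_i Σᶠ_c Δ·Φ(c, g_i) = Σ_i b_i Φ^st(γ_H, φ_i^H)
= Φ^st(γ_H, Σ_i b_i • φ_i^H)` on `V := ι⁻¹(W) ∩ ⋂_i V_i` (finite supports ★ `finite_support_delta_mul_classOrbitalIntegral_of_isLocSmooth`; additivity ★ p846349).

* `localTransferAtOne_of_germExpansion` — THE GERM FOLD (any transfer factor data `T`, any `m_G`, `m_H` admissible on the `G`-regular classes).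

## References
* [Rogawski1990] J. D. Rogawski, *Automorphic Representations of Unitary Groups in Three Variables* (1990), §8.1 Prop. 8.1.1 p. 112; §4.3 (4.3.1)–(4.3.2) p. 43; §4.9
  Prop. 4.9.1 (a) pp. 54–55.
* [HarishChandra1999AdmissibleDistributions] Harish-Chandra, *Admissible Invariant Distributions on Reductive p-adic Groups*, AMS ULS 16 (1999), Thm. 8.1 p. 48.
* [LanglandsShelstad1990Descent] R. P. Langlands, D. Shelstad, *Descent for transfer factors* (1990), §2.1 (2.1.2).
-/

set_option autoImplicit false

noncomputable section

open MeasureTheory Measure Set Filter Topology NumberField IsDedekindDomain Matrix Polynomial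
open scoped Matrix MatrixGroups

namespace Literature.NumberTheory.Rogawski1990

open Literature.NumberTheory.Automorphic Literature.NumberTheory.Automorphic.UnitaryGroup

variable (L : Type) [Field L] [NumberField L] [IsCMField L] (H' : Matrix (Fin 3) (Fin 3) L) (v : HeightOneSpectrum (𝓞 ↥(maximalRealSubfield L)))
  [∀ γ : ((cmDatum L 3 H').Local v), MeasurableSpace (((cmDatum L 3 H').Local v) ⧸ Subgroup.centralizer ({γ} : Set ((cmDatum L 3 H').Local v)))]
  [∀ a : (cmDatum L 2 (Matrix.of fun i j : Fin 2 => if i.val + j.val + 1 = 2 then (1 : L) else 0)).Local v × (cmDatum L 1 (Matrix.of fun i j : Fin 1 => if i.val + j.val + 1 = 1 then (1 : L) else 0)).Local v, MeasurableSpace (((cmDatum L 2 (Matrix.of fun i j : Fin 2 => if i.val + j.val + 1 = 2 then (1 : L) else 0)).Local v × (cmDatum L 1 (Matrix.of fun i j : Fin 1 => if i.val + j.val + 1 = 1 then (1 : L) else 0)).Local v) ⧸ Subgroup.centralizer ({a} : Set ((cmDatum L 2 (Matrix.of fun i j : Fin 2 => if i.val + j.val + 1 = 2 then (1 : L) else 0)).Local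 v × (cmDatum L 1 (Matrix.of fun i j : Fin 1 => if i.val + j.val + 1 = 1 then (1 : L) else 0)).Local v)))]
  [∀ a : (cmDatum L 2 (Matrix.of fun i j : Fin 2 => if i.val + j.val + 1 = 2 then (1 : L) else 0)).Local v × (cmDatum L 1 (Matrix.of fun i j : Fin 1 => if i.val + j.val + 1 = 1 then (1 : L) else 0)).Local v, BorelSpace (((cmDatum L 2 (Matrix.of fun i j : Fin 2 => if i.val + j.val + 1 = 2 then (1 : L) else 0)).Local v × (cmDatum L 1 (Matrix.of fun i j : Fin 1 => if i.val + j.val + 1 = 1 then (1 : L) else 0)).Local v) ⧸ Subgroup.centralizer ({a} : Set ((cmDatum L 2 (Matrix.of fun i j : Fin 2 => if i.val + j.val + 1 = 2 then (1 : L) else 0)).Local v × (cmDatum L 1 (Matrix.of fun i j : Fin 1 => if i.val + j.val + 1 = 1 then (1 : L) else 0)).Local v)))]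

set_option maxHeartbeats 400000 in
/-- **THE GERM FOLD (route (A) «SHALIKA»).**  `T` any transfer factor data, `m_G` any family, `m_H` admissible on the `G`-regular classes; germ data `(S, mU, Γ)` with the
expansion `hgerm` near `1` (the last conjunct of ★ `ShalikaGermExpansionNonsplit` verbatim); reference pieces `g_i ∈ C_c^∞` with local transfers `htr` at the identity
(the PARTIAL HEAD's conclusion); `f ∈ C_c^∞` whose unipotent row is spanned, `hspan`.  Then `f` has a local transfer at the identity — the conclusion of `stub_N6nsS3id` at `v`
for `f`. [cite: Rogawski1990, §8.1 Prop. 8.1.1 p. 112; §4.3 (4.3.1) p. 43; §4.9 Prop. 4.9.1 (a) p. 55] [cite: LanglandsShelstad1990Descent, §2.1 (2.1.2)] -/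
theorem localTransferAtOne_of_germExpansion (hH' : (H'.map (cmConjRingHom L))ᵀ = H') (hdet' : H'.det ≠ 0)
    {mH : OrbitalMeasureFamily ((cmDatum L 2 (Matrix.of fun i j : Fin 2 => if i.val + j.val + 1 = 2 then (1 : L) else 0)).Local v × (cmDatum L 1 (Matrix.of fun i j : Fin 1 => if i.val + j.val + 1 = 1 then (1 : L) else 0)).Local v)} (hmH : mH.IsAdmissibleOn (IsLocalGRegular L v))
    (T : LocalTransferFactor L H' v) (mG : OrbitalMeasureFamily ((cmDatum L 3 H').Local v))
    -- the germ data near `1`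
    (S : Finset (ConjClasses ((cmDatum L 3 H').Local v))) (mU : OrbitalMeasureFamily ((cmDatum L 3 H').Local v))
    (Γ : ConjClasses ((cmDatum L 3 H').Local v) → ConjClasses ((cmDatum L 3 H').Local v) → ℂ)
    (hgerm : ∀ h : (cmDatum L 3 H').Local v → ℂ, IsLocSmooth h →
      ∃ W ∈ 𝓝 (fun i : Fin 3 => ((1 : Matrix (Fin 3) (Fin 3) (UnitaryGroup.LocalRing L v)).charpoly).coeff i),
        ∀ c : ConjClasses ((cmDatum L 3 H').Local v),
          IsRegularElt ((Quotient.out c : (cmDatum L 3 H').Local v).val : GL (Fin 3) (UnitaryGroup.LocalRing L v)) →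
          (fun i : Fin 3 => ((Quotient.out c : (cmDatum L 3 H').Local v).val : GL (Fin 3) (UnitaryGroup.LocalRing L v)).val.charpoly.coeff i) ∈ W →
            classOrbitalIntegral mG h c = ∑ u ∈ S, classOrbitalIntegral mU h u * Γ u c)
    -- the reference pieces and their transfers at the identity
    {ι : Type*} [Fintype ι] (gref : ι → (cmDatum L 3 H').Local v → ℂ) (hgref : ∀ i, IsLocSmooth (gref i))
    (htr : ∀ i, ∃ V ∈ 𝓝 (1 : ((cmDatum L 2 (Matrix.of fun i j : Fin 2 => if i.val + j.val + 1 = 2 then (1 : L) else 0)).Local v × (cmDatum L 1 (Matrix.of fun i j : Fin 1 => if i.val + j.val + 1 = 1 then (1 : L) else 0)).Local v)), ∃ φH : ((cmDatum L 2 (Matrix.of fun i j : Fin 2 => if i.val + j.val + 1 = 2 then (1 : L) else 0)).Local v × (cmDatum L 1 (Matrix.of fun i j : Fin 1 => if i.val + j.val + 1 = 1 then (1 : L) else 0)).Local v) → ℂ, IsLocSmooth φH ∧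
      ∀ γH ∈ V, IsLocalGRegular L v γH →
        stableOrbitalIntegralRel (IsLocalStablyConjH L v) mH φH γH =
          ∑ᶠ c : ConjClasses ((cmDatum L 3 H').Local v), T.Δ γH (Quotient.out c) * classOrbitalIntegral mG (gref i) c)
    -- the test function and the spanning of its unipotent row
    (f : (cmDatum L 3 H').Local v → ℂ) (hf : IsLocSmooth f)
    (hspan : ∃ b : ι → ℂ, ∀ u ∈ S, classOrbitalIntegral mU f u = ∑ i, b i * classOrbitalIntegral mU (gref i) u) :
    ∃ V ∈ 𝓝 (1 : ((cmDatum L 2 (Matrix.of fun i j : Fin 2 => if i.val + j.val + 1 = 2 then (1 : L) else 0)).Local v × (cmDatum L 1 (Matrix.of fun i j : Fin 1 => if i.val + j.val + 1 = 1 then (1 : L) else 0)).Local v)), ∃ φH : ((cmDatum L 2 (Matrix.of fun i j : Fin 2 => if i.val + j.val + 1 = 2 then (1 : L) else 0)).Local v × (cmDatum L 1 (Matrix.of fun i j : Fin 1 => if i.val + j.val + 1 = 1 then (1 : L) else 0)).Local v) → ℂ, IsLocSmooth φH ∧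
      ∀ γH ∈ V, IsLocalGRegular L v γH →
        stableOrbitalIntegralRel (IsLocalStablyConjH L v) mH φH γH =
          ∑ᶠ c : ConjClasses ((cmDatum L 3 H').Local v), T.Δ γH (Quotient.out c) * classOrbitalIntegral mG f c := by
  classical
  obtain ⟨b, hb⟩ := hspan
  obtain ⟨Wf, hWf, hgf⟩ := hgerm f hf
  choose Wg hWg hgg using fun i => hgerm (gref i) (hgref i)
  choose Vg hVg φg hφg htrg using htr
  -- the coefficient map `γ_H ↦ (coefficients of the characteristic polynomial of ι_v(γ_H))`: continuous, `(X − 1)³` at `1`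
  set cH : ((cmDatum L 2 (Matrix.of fun i j : Fin 2 => if i.val + j.val + 1 = 2 then (1 : L) else 0)).Local v × (cmDatum L 1 (Matrix.of fun i j : Fin 1 => if i.val + j.val + 1 = 1 then (1 : L) else 0)).Local v) → (Fin 3 → UnitaryGroup.LocalRing L v) :=
    fun a i => ((((endoEmbLocal L v a).val : GL (Fin 3) (UnitaryGroup.LocalRing L v)).val).charpoly).coeff i with hcHdef
  have hcHc : Continuous cH :=
    continuous_pi fun i => (Literature.LinearAlgebra.Matrix.continuous_charpoly_coeff (i : ℕ)).comp
      (Units.continuous_val.comp (continuous_subtype_val.comp (continuous_endoEmbLocal L v)))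
  have hcH1 : cH 1 = fun i : Fin 3 => ((1 : Matrix (Fin 3) (Fin 3) (UnitaryGroup.LocalRing L v)).charpoly).coeff i := by
    funext i
    simp only [hcHdef, map_one]
    rfl
  have hW : (Wf ∩ ⋂ i, Wg i) ∈ 𝓝 (cH 1) := by
    rw [hcH1]; exact Filter.inter_mem hWf ((Filter.iInter_mem).2 hWg)
  -- additivity of `Φ^st` on `C_c^∞` at `G`-regular points
  have hA := fun x (hx : IsLocalGRegular L v x) F G (hF : IsLocSmooth F) (hG : IsLocSmooth G) =>
    localStableOrbitalIntegralH_add_of_isLocSmooth L v hmH x hx F G hF hG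
  refine ⟨cH ⁻¹' (Wf ∩ ⋂ i, Wg i) ∩ ⋂ i, Vg i, Filter.inter_mem (hcHc.continuousAt.preimage_mem_nhds hW) ((Filter.iInter_mem).2 hVg),
    ∑ i, b i • φg i, IsLocSmooth.finset_sum Finset.univ fun i _ => (hφg i).const_smul (b i), ?_⟩
  intro γH hγ hreg
  obtain ⟨hγW, hγV⟩ := hγ
  have hγW' : cH γH ∈ Wf ∩ ⋂ i, Wg i := hγW
  -- the `H`-side: linearity
  rw [stableOrbitalIntegralRel_finset_sum_of_isLocSmooth mH hA hreg Finset.univ (fun i => b i • φg i) fun i _ => (hφg i).const_smul (b i),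
    Finset.sum_congr rfl fun i _ => by rw [stableOrbitalIntegralRel_smul_fun _ mH (b i) (φg i) γH, htrg i γH (Set.mem_iInter.1 hγV i) hreg]]
  -- the `G′`-side: class by class, `Φ(c, f) = Σ_i b_i Φ(c, g_i)` wherever `Δ(γ_H, c) ≠ 0`
  have hpt : ∀ c : ConjClasses ((cmDatum L 3 H').Local v),
      T.Δ γH (Quotient.out c) * classOrbitalIntegral mG f c = ∑ i, b i * (T.Δ γH (Quotient.out c) * classOrbitalIntegral mG (gref i) c) := by
    intro c
    by_cases hΔ : T.Δ γH (Quotient.out c) = 0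
    · simp only [hΔ, zero_mul, mul_zero, Finset.sum_const_zero]
    · have hnp : IsLocalNormPair L H' v γH (Quotient.out c) := by
        by_contra h; exact hΔ (T.eq_zero_of_not_rel _ _ h)
      have hregc : IsRegularElt ((Quotient.out c : (cmDatum L 3 H').Local v).val : GL (Fin 3) (UnitaryGroup.LocalRing L v)) :=
        isRegularElt_of_isLocalNormPair L H' v hnp hreg
      have hcoef : (fun i : Fin 3 => ((Quotient.out c : (cmDatum L 3 H').Local v).val : GL (Fin 3) (UnitaryGroup.LocalRing L v)).val.charpoly.coeff i) = cH γH := by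
        funext i
        simp only [hcHdef]
        rw [hnp.charpoly_eq L H' v, charpoly_endoEmbLocal]
      have hcWf : (fun i : Fin 3 => ((Quotient.out c : (cmDatum L 3 H').Local v).val : GL (Fin 3) (UnitaryGroup.LocalRing L v)).val.charpoly.coeff i) ∈ Wf := by
        rw [hcoef]; exact hγW'.1
      have hcWg : ∀ i, (fun i : Fin 3 => ((Quotient.out c : (cmDatum L 3 H').Local v).val : GL (Fin 3) (UnitaryGroup.LocalRing L v)).val.charpoly.coeff i) ∈ Wg i := by
        intro i; rw [hcoef]; exact Set.mem_iInter.1 hγW'.2 i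
      rw [hgf c hregc hcWf, Finset.sum_congr rfl fun u hu => by rw [hb u hu]]
      have hG : ∀ i, classOrbitalIntegral mG (gref i) c = ∑ u ∈ S, classOrbitalIntegral mU (gref i) u * Γ u c :=
        fun i => hgg i c hregc (hcWg i)
      -- `Δ · Σ_u (Σ_i b_i X_{iu}) Γ_u = Σ_i b_i (Δ · Σ_u X_{iu} Γ_u)`
      simp only [hG, Finset.sum_mul, Finset.mul_sum]
      exact Finset.sum_comm.trans (Finset.sum_congr rfl fun i _ => Finset.sum_congr rfl fun u _ => by ring)
  rw [finsum_congr hpt]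
  -- swap `Σᶠ_c` and `Σ_i` (finite supports) and pull out the scalars
  have hfin : ∀ i, (Function.support fun c : ConjClasses ((cmDatum L 3 H').Local v) =>
      T.Δ γH (Quotient.out c) * classOrbitalIntegral mG (gref i) c).Finite := fun i =>
    finite_support_delta_mul_classOrbitalIntegral_of_isLocSmooth L H' v hH' hdet' T mG (gref i) (hgref i) γH hreg
  have hfin' : ∀ i ∈ (Finset.univ : Finset ι), (Function.support fun c : ConjClasses ((cmDatum L 3 H').Local v) =>
      b i * (T.Δ γH (Quotient.out c) * classOrbitalIntegral mG (gref i) c)).Finite := fun i _ =>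
    (hfin i).subset (Function.support_mul_subset_right _ _)
  rw [finsum_sum_comm Finset.univ _ hfin']
  exact Finset.sum_congr rfl fun i _ => mul_finsum' _ (b i) (hfin i)

end Literature.NumberTheory.Rogawski1990

end
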